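import Literature.NumberTheory.Transcendental.KZLogCalculusProofs
import Literature.NumberTheory.Transcendental.KZDominatedFamilyRelations
import Literature.NumberTheory.Transcendental.SemialgebraicMapsProofs
import Literature.NumberTheory.Transcendental.KZMellinFibres
import Summits.KontsevichZagierPeriods.KontsevichZagierPeriods.Theorems.UnfoldedStokesStokesGenerationStubSpanToReps
import Summits.KontsevichZagierPeriods.KontsevichZagierPeriods.Theorems.SymplecticScissorsCubeNashNormalFormChartCompiler
import HarnessLib

/-!
# Crux `ContinuousCubification` (stmt-KontsevichZagierPeriods-17853), line `SketchIdeator1` — stub `stub_damping`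

**Korobov damping.** A KZ integral representation on the OPEN unit cube `(0,1)^M` with bounded
integrand continuous on the open cube is congruent modulo `KZ.relations` to a representation on the
CLOSED cube `[0,1]^M` with integrand continuous on the closed cube. ONE rule-(2) move along the
cubic smoothstep self-map `Θ(v)ᵢ = θ(vᵢ)`, `θ(s) = 3s² − 2s³`, with diagonal derivative
`diag(θ'(vᵢ))`, `θ'(s) = 6s(1−s)`, of determinant `∏ᵢ θ'(vᵢ) > 0` inside and `= 0` on the whole
boundary: the damped integrand `(g ∘ Θ)·∏θ'` extended by `0` is continuous on the closed cube
(`damped_continuousOn`, squeeze against `|B|·6^M·|θ'(v_{i₀})|`); the move is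
`korobov_mem_changeOfVariablesRel` (`Θ` is a `ℚ`-polynomial map, injective and onto on the open
cube); the boundary `[0,1]^M ∖ (0,1)^M` is null (`volume_piIcc_diff_piIoo`,
`KZ.IntegralRep.of_sub_of_restrict_mem_relations`); `ℚ`-semialgebraicity on the closed cube is
`isSemialgebraicFunOn_piIcc_of_piIoo`. Credit: the block `cube … damping` of the crux-ideate sketch
`Cruxes/ContinuousCubification/SketchIdeator1.lean` (card `korobov-damping`), helpers moved to the
sub-namespace `KorobovDamping`; the registered statement `stub_damping` is derived at the end.
Not here: cell decomposition, cell flattening, merging (the line's other stubs).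
-/

noncomputable section

-- `Summit.<S>.<Sub>` with Sub = S (single-conjunct summit, D-0017) duplicates the segment.
set_option linter.dupNamespace false

namespace Summit.KontsevichZagierPeriods.KontsevichZagierPeriods.ContinuousCubificationLine

open MeasureTheory Set Filter Topology
open Literature.NumberTheory.Transcendental
open Literature.NumberTheory.Transcendental.KZ
open Literature.ModelTheory.ExponentialFields (IsSemialgebraic)
open Summit.KontsevichZagierPeriods.KontsevichZagierPeriods.StokesGenerationLine
  (isSemialgebraic_cubePi)
open Summit.KontsevichZagierPeriods.SymplecticScissors.CubeNashNormalFormChartCompiler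
  (isSemialgebraicFunOn_piIcc_of_piIoo volume_piIcc_diff_piIoo)

namespace KorobovDamping

variable {M : ℕ}

/-- The closed unit cube `[0,1]^M` (the crux's `Set.pi Set.univ (fun _ => Set.Icc 0 1)`). -/
abbrev cube (M : ℕ) : Set (Fin M → ℝ) := Set.pi Set.univ (fun _ : Fin M => Set.Icc (0:ℝ) 1)

/-- The open unit cube `(0,1)^M`. -/
abbrev openCube (M : ℕ) : Set (Fin M → ℝ) := Set.pi Set.univ (fun _ : Fin M => Set.Ioo (0:ℝ) 1)

/-- Korobov's cubic smoothstep `θ(s) = 3s² − 2s³`: `θ(0) = 0`, `θ(1) = 1`, `θ' = 6s(1−s)`. -/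
def kstep (s : ℝ) : ℝ := 3 * s ^ 2 - 2 * s ^ 3

/-- Its derivative `θ'(s) = 6 s (1 − s)`. -/
def kstepDeriv (s : ℝ) : ℝ := 6 * s * (1 - s)

/-- The damping self-map of the cube `Θ(v)ᵢ = θ(vᵢ)` (a `ℚ`-polynomial map; `Θ = dampMap`). -/
def dampMap (v : Fin M → ℝ) : Fin M → ℝ := fun i => kstep (v i)

/-- Its Jacobian determinant `∏ᵢ θ'(vᵢ)` (the derivative is diagonal). -/
def dampJac (v : Fin M → ℝ) : ℝ := ∏ i, kstepDeriv (v i)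

open Classical in
/-- The damped integrand: `g(Θ v) · ∏ θ'(vᵢ)` on the open cube, `0` elsewhere (in particular on the
boundary of the cube). -/
def damp (g : (Fin M → ℝ) → ℝ) (v : Fin M → ℝ) : ℝ :=
  if v ∈ openCube M then g (dampMap v) * dampJac v else 0

/-! ### Elementary facts about the smoothstep -/

/-- The smoothstep maps the open unit interval into itself:
`θ(s) = s²(3 − 2s) > 0` and `1 − θ(s) = (1−s)²(1+2s) > 0` for `0 < s < 1`. -/
theorem kstep_mem_Ioo {s : ℝ} (hs : s ∈ Ioo (0:ℝ) 1) : kstep s ∈ Ioo (0:ℝ) 1 := by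
  obtain ⟨h0, h1⟩ := hs
  constructor
  · have : kstep s = s ^ 2 * (3 - 2 * s) := by unfold kstep; ring
    rw [this]; exact mul_pos (pow_pos h0 2) (by linarith)
  · have : 1 - kstep s = (1 - s) ^ 2 * (1 + 2 * s) := by unfold kstep; ring
    have h : 0 < (1 - s) ^ 2 * (1 + 2 * s) := mul_pos (pow_pos (by linarith) 2) (by linarith)
    linarith

/-- `Θ` maps the open cube into itself. -/
theorem dampMap_mem_openCube {v : Fin M → ℝ} (hv : v ∈ openCube M) : dampMap v ∈ openCube M :=
  fun i _ => kstep_mem_Ioo (hv i (mem_univ _))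

/-- `θ` is continuous (a polynomial). -/
theorem continuous_kstep : Continuous kstep := by
  unfold kstep; fun_prop

/-- `θ'` is continuous (a polynomial). -/
theorem continuous_kstepDeriv : Continuous kstepDeriv := by
  unfold kstepDeriv; fun_prop

/-- `Θ` is continuous (coordinatewise polynomial). -/
theorem continuous_dampMap : Continuous (dampMap : (Fin M → ℝ) → Fin M → ℝ) :=
  continuous_pi fun i => continuous_kstep.comp (continuous_apply i)

/-- The Jacobian `∏ᵢ θ'(vᵢ)` is continuous. -/
theorem continuous_dampJac : Continuous (dampJac : (Fin M → ℝ) → ℝ) := by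
  unfold dampJac
  exact continuous_finsetProd _ fun i _ => continuous_kstepDeriv.comp (continuous_apply i)

/-- `|θ'(s)| ≤ 6` on `[0,1]`. -/
theorem abs_kstepDeriv_le {s : ℝ} (hs : s ∈ Icc (0:ℝ) 1) : |kstepDeriv s| ≤ 6 := by
  obtain ⟨h0, h1⟩ := hs
  rw [abs_le]
  unfold kstepDeriv
  constructor <;> nlinarith [mul_nonneg h0 (sub_nonneg.mpr h1)]

/-- `θ'` vanishes at the endpoints: if `s ∈ [0,1] ∖ (0,1)` then `θ'(s) = 0`. -/
theorem kstepDeriv_eq_zero_of_not_mem {s : ℝ} (hs : s ∈ Icc (0:ℝ) 1) (hs' : s ∉ Ioo (0:ℝ) 1) :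
    kstepDeriv s = 0 := by
  obtain ⟨h0, h1⟩ := hs
  simp only [mem_Ioo, not_and_or, not_lt] at hs'
  unfold kstepDeriv
  rcases hs' with h | h
  · simp [le_antisymm h h0]
  · simp [le_antisymm h1 h]

/-- The open cube is open. -/
theorem isOpen_openCube : IsOpen (openCube M) :=
  isOpen_set_pi finite_univ fun _ _ => isOpen_Ioo

/-- The open cube is contained in the closed cube. -/
theorem openCube_subset_cube : openCube M ⊆ cube M :=
  Set.pi_mono fun _ _ => Ioo_subset_Icc_self

/-- On the closed cube the Jacobian is dominated by any one of its factors: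
`|∏ θ'(vᵢ)| ≤ 6^M · |θ'(v_{i₀})|`. -/
theorem abs_dampJac_le {v : Fin M → ℝ} (hv : v ∈ cube M) (i₀ : Fin M) :
    |dampJac v| ≤ 6 ^ M * |kstepDeriv (v i₀)| := by
  classical
  unfold dampJac
  rw [← Finset.mul_prod_erase Finset.univ (fun i => kstepDeriv (v i)) (Finset.mem_univ i₀), abs_mul,
    Finset.abs_prod, mul_comm]
  refine mul_le_mul_of_nonneg_right ?_ (abs_nonneg _)
  calc ∏ i ∈ Finset.univ.erase i₀, |kstepDeriv (v i)|
      ≤ ∏ _i ∈ Finset.univ.erase i₀, (6:ℝ) := Finset.prod_le_prod (fun _ _ => abs_nonneg _)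
        fun i _ => abs_kstepDeriv_le (hv i (mem_univ _))
    _ = 6 ^ (Finset.univ.erase i₀).card := Finset.prod_const _
    _ ≤ 6 ^ M := pow_le_pow_right₀ (by norm_num) (Finset.card_erase_le.trans (by simp))

/-! ### (a) The damped integrand is continuous on the CLOSED cube -/

/-- **Damping makes bounded integrands continuous up to the boundary.** If `g` is continuous on
the open cube and bounded there, then `damp g` (`= (g ∘ Θ) · ∏ θ'(vᵢ)` inside, `0` on the
boundary) is continuous on the closed cube. Proof: inside, a product of continuous functions
(`Θ` maps the open cube into itself); at a boundary point `v₀` some coordinate `v₀ i₀ ∈ {0,1}`, and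
`|damp g v| ≤ |B| · 6^M · |θ'(v_{i₀})| → 0`. -/
theorem damped_continuousOn (g : (Fin M → ℝ) → ℝ) (B : ℝ) (hg : ContinuousOn g (openCube M))
    (hB : ∀ v ∈ openCube M, |g v| ≤ B) : ContinuousOn (damp g) (cube M) := by
  intro v₀ hv₀
  by_cases h : v₀ ∈ openCube M
  · -- interior point
    have hcont : ContinuousAt (fun v => g (dampMap v) * dampJac v) v₀ := by
      refine ContinuousAt.mul ?_ continuous_dampJac.continuousAt
      have hgat : ContinuousAt g (dampMap v₀) :=
        hg.continuousAt (isOpen_openCube.mem_nhds (dampMap_mem_openCube h))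
      exact hgat.comp continuous_dampMap.continuousAt
    have heq : damp g =ᶠ[𝓝 v₀] fun v => g (dampMap v) * dampJac v := by
      filter_upwards [isOpen_openCube.mem_nhds h] with v hv
      simp [damp, hv]
    exact (hcont.congr heq.symm).continuousWithinAt
  · -- boundary point: some coordinate is `0` or `1`
    have h' : ¬ ∀ i, v₀ i ∈ Ioo (0:ℝ) 1 := fun hall => h (fun i _ => hall i)
    obtain ⟨i₀, hi₀⟩ := not_forall.mp h'
    have hzero : kstepDeriv (v₀ i₀) = 0 := kstepDeriv_eq_zero_of_not_mem (hv₀ i₀ (mem_univ _)) hi₀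
    have hval : damp g v₀ = 0 := by simp [damp, h]
    -- the bound `‖damp g v‖ ≤ |B| * 6^M * |θ'(v i₀)|` on the closed cube
    have hbound : ∀ v ∈ cube M, ‖damp g v‖ ≤ |B| * 6 ^ M * |kstepDeriv (v i₀)| := by
      intro v hv
      rw [Real.norm_eq_abs]
      by_cases hv' : v ∈ openCube M
      · have h1 : |g (dampMap v)| ≤ |B| := (hB _ (dampMap_mem_openCube hv')).trans (le_abs_self B)
        have h2 : |dampJac v| ≤ 6 ^ M * |kstepDeriv (v i₀)| := abs_dampJac_le hv i₀
        have hrw : damp g v = g (dampMap v) * dampJac v := by simp [damp, hv']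
        rw [hrw, abs_mul]
        calc |g (dampMap v)| * |dampJac v| ≤ |B| * (6 ^ M * |kstepDeriv (v i₀)|) :=
              mul_le_mul h1 h2 (abs_nonneg _) (abs_nonneg _)
          _ = |B| * 6 ^ M * |kstepDeriv (v i₀)| := by ring
      · have hrw : damp g v = 0 := by simp [damp, hv']
        rw [hrw, abs_zero]
        positivity
    -- the majorant tends to `0` at `v₀` within the cube
    have hmaj : Tendsto (fun v : Fin M → ℝ => |B| * 6 ^ M * |kstepDeriv (v i₀)|) (𝓝[cube M] v₀)
        (𝓝 0) := by
      have hc : Continuous fun v : Fin M → ℝ => |B| * 6 ^ M * |kstepDeriv (v i₀)| :=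
        continuous_const.mul ((continuous_kstepDeriv.comp (continuous_apply i₀)).abs)
      have := hc.continuousAt (x := v₀)
      rw [ContinuousAt, hzero, abs_zero, mul_zero] at this
      exact this.mono_left nhdsWithin_le_nhds
    rw [ContinuousWithinAt, hval]
    exact squeeze_zero_norm' (eventually_nhdsWithin_of_forall hbound) hmaj

/-! ### (b) The damping is ONE change-of-variables move -/

/-- `θ` has derivative `θ'(s) = 6s(1−s)` at every `s`. -/
theorem hasDerivAt_kstep (s : ℝ) : HasDerivAt kstep (kstepDeriv s) s := by
  unfold kstep
  refine (((hasDerivAt_pow 2 s).const_mul (3:ℝ)).sub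
    ((hasDerivAt_pow 3 s).const_mul (2:ℝ))).congr_deriv ?_
  unfold kstepDeriv; push_cast; ring

/-- `θ` is strictly increasing on `[0,1]` (its derivative is positive on `(0,1)`). -/
theorem strictMonoOn_kstep : StrictMonoOn kstep (Icc (0:ℝ) 1) := by
  refine strictMonoOn_of_deriv_pos (convex_Icc 0 1) continuous_kstep.continuousOn fun x hx => ?_
  rw [interior_Icc] at hx
  rw [(hasDerivAt_kstep x).deriv]
  unfold kstepDeriv
  exact mul_pos (mul_pos (by norm_num) hx.1) (by linarith [hx.2])

/-- `Θ` is injective on the open cube (coordinatewise strict monotonicity of `θ`). -/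
theorem injOn_dampMap : InjOn (dampMap : (Fin M → ℝ) → Fin M → ℝ) (openCube M) := by
  intro x hx y hy hxy
  funext i
  have h : kstep (x i) = kstep (y i) := congr_fun hxy i
  exact strictMonoOn_kstep.injOn (Ioo_subset_Icc_self (hx i (mem_univ _)))
    (Ioo_subset_Icc_self (hy i (mem_univ _))) h

/-- `Θ` maps the open cube ONTO the open cube (intermediate value theorem for `θ` on `[0,1]`,
`θ(0) = 0`, `θ(1) = 1`). -/
theorem image_dampMap_openCube : dampMap '' openCube M = openCube M := by
  classical
  refine Subset.antisymm ?_ ?_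
  · rintro _ ⟨v, hv, rfl⟩
    exact dampMap_mem_openCube hv
  · intro y hy
    have key : ∀ i, ∃ s ∈ Ioo (0:ℝ) 1, kstep s = y i := by
      intro i
      have hIVT := intermediate_value_Ioo (zero_le_one : (0:ℝ) ≤ 1) continuous_kstep.continuousOn
      have h0 : kstep 0 = 0 := by norm_num [kstep]
      have h1 : kstep 1 = 1 := by norm_num [kstep]
      rw [h0, h1] at hIVT
      exact hIVT (hy i (mem_univ _))
    choose x hx hxy using key
    exact ⟨x, fun i _ => hx i, funext fun i => hxy i⟩

/-- The Jacobian `∏ᵢ θ'(vᵢ)` is positive on the open cube. -/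
theorem dampJac_pos {v : Fin M → ℝ} (hv : v ∈ openCube M) : 0 < dampJac v := by
  unfold dampJac
  refine Finset.prod_pos fun i _ => ?_
  obtain ⟨h0, h1⟩ := hv i (mem_univ _)
  unfold kstepDeriv
  exact mul_pos (mul_pos (by norm_num) h0) (by linarith)

/-- The derivative of `Θ` at `v` is the diagonal map `diag(θ'(vᵢ))`, of determinant `∏ θ'(vᵢ)`. -/
theorem hasFDerivAt_dampMap (v : Fin M → ℝ) :
    ∃ L : (Fin M → ℝ) →L[ℝ] (Fin M → ℝ), L.det = dampJac v ∧ HasFDerivAt dampMap L v := by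
  classical
  let Mx : Matrix (Fin M) (Fin M) ℝ := Matrix.diagonal fun i => kstepDeriv (v i)
  let L : (Fin M → ℝ) →L[ℝ] (Fin M → ℝ) := LinearMap.toContinuousLinearMap (Matrix.toLin' Mx)
  have hL : ∀ w i, L w i = kstepDeriv (v i) * w i := by
    intro w i
    change Matrix.toLin' Mx w i = _
    rw [Matrix.toLin'_apply, Matrix.mulVec_diagonal]
  have hdet : L.det = dampJac v := by
    change LinearMap.det (Matrix.toLin' Mx) = _
    rw [LinearMap.det_toLin', Matrix.det_diagonal]
    rfl
  refine ⟨L, hdet, hasFDerivAt_pi'' fun i => ?_⟩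
  have h1 : HasFDerivAt (kstep ∘ fun y : Fin M → ℝ => y i)
      ((ContinuousLinearMap.smulRight (1 : ℝ →L[ℝ] ℝ) (kstepDeriv (v i))).comp
        (ContinuousLinearMap.proj i)) v :=
    HasFDerivAt.comp v (hasDerivAt_kstep (v i)).hasFDerivAt (hasFDerivAt_apply i v)
  have h2 : (fun y : Fin M → ℝ => dampMap y i) = (kstep ∘ fun y : Fin M → ℝ => y i) := rfl
  rw [h2]
  refine h1.congr_fderiv (ContinuousLinearMap.ext fun w => ?_)
  simp only [ContinuousLinearMap.comp_apply, ContinuousLinearMap.smulRight_apply,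
    one_apply_eq_self, ContinuousLinearMap.proj_apply, smul_eq_mul, hL]
  ring

/-- The substitution polynomials `3 Xᵢ² − 2 Xᵢ³` of `Θ` (for `ℚ`-semialgebraicity of the move). -/
def kstepSubst (i : Fin M) : MvPolynomial (Fin M) ℚ :=
  3 * MvPolynomial.X i ^ 2 - 2 * MvPolynomial.X i ^ 3

/-- Evaluating the substitution polynomial `3 Xᵢ² − 2 Xᵢ³` at `x` gives `θ(xᵢ)`. -/
theorem aeval_kstepSubst (x : Fin M → ℝ) (i : Fin M) :
    MvPolynomial.aeval x (kstepSubst i) = kstep (x i) := by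
  simp only [kstepSubst, kstep, map_sub, map_mul, map_pow, MvPolynomial.aeval_X, map_ofNat]

/-- **The Korobov move.** For representations `r` (integrand `(g ∘ Θ)·∏θ'`) and `r'` (integrand
`g`) on the open cube, `[r] − [r'] ∈ KZ.changeOfVariablesRel` along `Φ = Θ` with the diagonal
derivative `Φ' v = diag(θ'(vᵢ))`: `Θ` is a `ℚ`-polynomial map, injective on the open cube (θ is
strictly increasing on `[0,1]`), `Θ '' (0,1)^M = (0,1)^M`, `|det Φ' v| = ∏ θ'(vᵢ) > 0`.
(Witness shape = playbook "Rule (2) move witness".) -/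
theorem korobov_mem_changeOfVariablesRel (r r' : IntegralRep M) (hr : r.domain = openCube M)
    (hr' : r'.domain = openCube M)
    (hint : ∀ v ∈ openCube M, r.integrand v = r'.integrand (dampMap v) * dampJac v) :
    of r - of r' ∈ changeOfVariablesRel := by
  classical
  choose L hLdet hL using fun v : Fin M → ℝ => hasFDerivAt_dampMap (M := M) v
  refine ⟨M, r, r', dampMap, L, ?_, fun v _ => (hL v).hasFDerivWithinAt, ?_, ?_,
    fun v hv => ?_, rfl⟩
  · convert isSemialgebraicMapOn_aeval r.isSemialgebraic_domain (kstepSubst (M := M)) using 2 with x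
    funext i
    exact (aeval_kstepSubst x i).symm
  · rw [hr]
    exact injOn_dampMap
  · rw [hr, hr', image_dampMap_openCube]
  · have hv' : v ∈ openCube M := by rw [← hr]; exact hv
    rw [hLdet, abs_of_pos (dampJac_pos hv')]
    exact hint v hv'

/-- The open unit cube is `ℚ`-semialgebraic. -/
theorem isSemialgebraic_openCube : IsSemialgebraic ℚ (openCube M) := by
  convert KZ.isSemialgebraic_box M using 1
  ext x; simp only [mem_univ_pi, mem_setOf_eq]

/-- `Θ` is a `ℚ`-semialgebraic map on every `ℚ`-semialgebraic set (it is a `ℚ`-polynomial map). -/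
theorem isSemialgebraicMapOn_dampMap {s : Set (Fin M → ℝ)} (hs : IsSemialgebraic ℚ s) :
    IsSemialgebraicMapOn ℚ s (dampMap : (Fin M → ℝ) → Fin M → ℝ) := by
  convert isSemialgebraicMapOn_aeval hs (kstepSubst (M := M)) using 2 with x
  funext i
  exact (aeval_kstepSubst x i).symm

/-- The Jacobian `∏ᵢ 6vᵢ(1−vᵢ)` is a `ℚ`-semialgebraic function on every `ℚ`-semialgebraic set
(it is a `ℚ`-polynomial). -/
theorem isSemialgebraicFunOn_dampJac {s : Set (Fin M → ℝ)} (hs : IsSemialgebraic ℚ s) :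
    IsSemialgebraicFunOn ℚ s (dampJac : (Fin M → ℝ) → ℝ) := by
  refine (isSemialgebraicFunOn_aeval hs
    (∏ i : Fin M, (6 * MvPolynomial.X i * (1 - MvPolynomial.X i) : MvPolynomial (Fin M) ℚ))).congr
    fun v _ => ?_
  simp only [dampJac, kstepDeriv, map_prod, map_mul, map_sub, map_one, MvPolynomial.aeval_X,
    map_ofNat]

/-- **The lever, as consumed by the line** (from (a), (b), the null boundary `cube ∖ openCube` and
`IntegralRep.of_sub_of_restrict_mem_relations`): a representation on the OPEN cube with BOUNDED
integrand, continuous there, is congruent modulo the moves to a CLOSED-cube representation whose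
integrand is continuous on the closed cube — namely `[cube, damp g]`. -/
theorem damping (r : IntegralRep M) (B : ℝ) (hr : r.domain = openCube M)
    (hc : ContinuousOn r.integrand r.domain) (hB : ∀ v ∈ r.domain, |r.integrand v| ≤ B) :
    ∃ t : IntegralRep M, t.domain = cube M ∧ ContinuousOn t.integrand t.domain ∧
      EqOn t.integrand (damp r.integrand) (cube M) ∧ of r - of t ∈ relations := by
  have hgc : ContinuousOn r.integrand (openCube M) := by rw [← hr]; exact hc
  have hgB : ∀ v ∈ openCube M, |r.integrand v| ≤ B := fun v hv => hB v (by rw [hr]; exact hv)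
  have hcont : ContinuousOn (damp r.integrand) (cube M) := damped_continuousOn r.integrand B hgc hgB
  -- `ℚ`-semialgebraicity: a composite times a polynomial on the open cube, then graph closure
  have hsaO : IsSemialgebraicFunOn ℚ (openCube M) (damp r.integrand) := by
    have hg : IsSemialgebraicFunOn ℚ (openCube M) r.integrand := by
      rw [← hr]; exact r.isSemialgebraicFunOn_integrand
    have h1 : IsSemialgebraicFunOn ℚ (openCube M) (r.integrand ∘ dampMap) :=
      IsSemialgebraicFunOn.comp_isSemialgebraicMapOn_holds hg
        (isSemialgebraicMapOn_dampMap isSemialgebraic_openCube) fun v hv => dampMap_mem_openCube hv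
    have h2 := isSemialgebraicFunOn_dampJac (M := M) isSemialgebraic_openCube
    exact (IsSemialgebraicFunOn.mul_holds h1 h2).congr fun v hv => by
      simp only [Pi.mul_apply, Function.comp_apply, damp, if_pos hv]
  have hsa : IsSemialgebraicFunOn ℚ (cube M) (damp r.integrand) :=
    isSemialgebraicFunOn_piIcc_of_piIoo hcont hsaO
  -- the closed-cube representation
  let t : IntegralRep M :=
    { domain := cube M
      integrand := damp r.integrand
      isSemialgebraic_domain := isSemialgebraic_cubePi M
      isSemialgebraicFunOn_integrand := hsa
      integrableOn := hcont.integrableOn_compact (isCompact_univ_pi fun _ => isCompact_Icc) }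
  refine ⟨t, rfl, hcont, fun _ _ => rfl, ?_⟩
  -- `[t] ≡ [t|(0,1)^M]` (null boundary) and `[t|(0,1)^M] − [r]` is the Korobov move
  have hnull : of t - of (t.restrict (openCube M) isSemialgebraic_openCube openCube_subset_cube) ∈
      relations :=
    IntegralRep.of_sub_of_restrict_mem_relations t isSemialgebraic_openCube openCube_subset_cube
      volume_piIcc_diff_piIoo
  have hcov : of (t.restrict (openCube M) isSemialgebraic_openCube openCube_subset_cube) - of r ∈
      changeOfVariablesRel :=
    korobov_mem_changeOfVariablesRel _ r rfl hr fun v hv => by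
      show damp r.integrand v = r.integrand (dampMap v) * dampJac v
      simp only [damp, if_pos hv]
  have e : of r - of t = -((of t - of (t.restrict (openCube M) isSemialgebraic_openCube
      openCube_subset_cube)) + (of (t.restrict (openCube M) isSemialgebraic_openCube
      openCube_subset_cube) - of r)) := by abel
  rw [e]
  exact relations.neg_mem (relations.add_mem hnull (changeOfVariablesRel_subset_relations hcov))

end KorobovDamping

/-- STUB S4 of the line (crux `ContinuousCubification`): **Korobov damping.** A representation
on the open unit cube `(0,1)^M` with bounded integrand continuous on the open cube is congruent
modulo the moves to a closed-cube representation whose integrand is continuous on the CLOSED cube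
`[0,1]^M` (smoothstep rule-(2) move, then the null boundary: `KorobovDamping.damping`). -/
theorem stub_damping :
    ∀ (M : ℕ) (r : IntegralRep M) (B : ℝ), r.domain = Set.pi Set.univ (fun _ : Fin M => Set.Ioo (0:ℝ) 1) →
      ContinuousOn r.integrand (Set.pi Set.univ (fun _ : Fin M => Set.Ioo (0:ℝ) 1)) →
      (∀ u ∈ Set.pi Set.univ (fun _ : Fin M => Set.Ioo (0:ℝ) 1), |r.integrand u| ≤ B) →
      ∃ t : IntegralRep M, t.domain = Set.pi Set.univ (fun _ : Fin M => Set.Icc (0:ℝ) 1) ∧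
        ContinuousOn t.integrand (Set.pi Set.univ (fun _ : Fin M => Set.Icc (0:ℝ) 1)) ∧
        of r - of t ∈ relations := by
  intro M r B hr hc hB
  obtain ⟨t, htd, htc, -, hrt⟩ := KorobovDamping.damping r B hr (by rw [hr]; exact hc)
    (fun v hv => hB v (by rw [← hr]; exact hv))
  exact ⟨t, htd, by rwa [htd] at htc, hrt⟩

end Summit.KontsevichZagierPeriods.KontsevichZagierPeriods.ContinuousCubificationLine

end
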